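import Literature.MathematicalPhysics.QuantumLattice.FreeFermiGasNoThermalPairFieldLRO
import Literature.MathematicalPhysics.QuantumLattice.HubbardWave0LiebProofs
import HarnessLib

/-!
# Crux `JmPairBridge` (stmt-HubbardSuperconductivity-2226), line `Sketch` (Schur landing):
# stub `stub_everyFromSome_torus`

Route `JosephsonMirror`, crux `JmPairBridge` (the every-ground-state pair bridge between the adjacent
charge-sector ground floors `(N_L, 0)`, `(N_L - 2, 0)` of the Hubbard torus). This file is the TORUS
INSTANCE of the abstract Schur rigidity lemma (`stub_schurBridge`, taken here as the hypothesis `hSB`):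
the `(N, 0)` and `(N - 2, 0)` ground floors of `hubbardTorus 2 L 1 U` as the subspaces
`szSector n 0 ⊓ eigenspace H (minEnergyOn H (szSector n 0))`, sector ground states
(`IsGroundStateInSector`) as their non-zero vectors, and a family `S` of unitaries commuting with `H`,
preserving both sectors and twisting `Δ_d = pairField dWaveFormFactor L` by unimodular phases.

Proof: a sector ground state of `H` in `(n, 0)` is exactly a non-zero vector of the floor
`szSector n 0 ⊓ eigenspace H (minEnergyOn H (szSector n 0))` (`isGroundStateInSector_iff_mem_floor`), and a
unit vector is non-zero. Each `X ∈ S` maps a floor into itself because it maps the sector into itself and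
commutes with `H` (`mulVec_mem_inf_eigenspace_of_commute`); so does `Xᴴ = X⁻¹`, because a unitary
mapping a subspace of the finite-dimensional `Fock` space into itself is a bijection of it
(`conjTranspose_mulVec_mem_of_unitary`, injective ⇒ surjective). With these the abstract lemma `hSB`
applies verbatim to `n := Finset (Orb (FermionTorus 2 L))`, `Δ := Δ_d`, the two floors and `S`.

Sources: J.-P. Serre, *Linear Representations of Finite Groups* §2.2 (Schur); H. Tasaki, *Physics and
Mathematics of Quantum Many-Body Systems* (2020) §2.1 (sector ground states). No definition, no named fact.
-/

noncomputable section

-- the mandated namespace `Summit.<Summit>.<Problem>.Theorems` repeats `HubbardSuperconductivity`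
-- (single-problem summit, D-0017), which the `dupNamespace` linter flags on every declaration
set_option linter.dupNamespace false

namespace Summit.HubbardSuperconductivity.HubbardSuperconductivity.Theorems.JosephsonMirror

open Matrix Literature.MathematicalPhysics.QuantumLattice
open scoped ComplexOrder

/-! ### Finite-dimensional linear algebra: invariance of floors, adjoints of unitaries -/

section Helpers

variable {n : Type*} [Fintype n] [DecidableEq n]

/-- A unitary matrix (`Xᴴ X = 1`) mapping a subspace `V` of the finite-dimensional space `n → ℂ` into
itself restricts to a bijection of `V` (injective, hence surjective by the dimension count), so its
adjoint `Xᴴ = X⁻¹` maps `V` into itself as well: `Xᴴ (X u) = u`.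
Serre, *Linear Representations of Finite Groups* §1.3. [folklore] -/
private theorem conjTranspose_mulVec_mem_of_unitary (V : Submodule ℂ (n → ℂ)) {X : Matrix n n ℂ}
    (hX : Xᴴ * X = 1) (hXV : ∀ v ∈ V, X *ᵥ v ∈ V) : ∀ v ∈ V, Xᴴ *ᵥ v ∈ V := by
  -- the restriction of `X` to `V`
  let f : Module.End ℂ V := (Matrix.toLin' X).restrict (p := V) (q := V) fun v hv => hXV v hv
  have hf : ∀ u : V, ((f u : V) : n → ℂ) = X *ᵥ (u : n → ℂ) := fun u => by
    simp [f, LinearMap.restrict_apply]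
  have hinj : Function.Injective f := by
    intro u w huw
    apply Subtype.ext
    have h := congrArg (fun z : V => Xᴴ *ᵥ ((z : V) : n → ℂ)) huw
    simp only [hf, mulVec_mulVec, hX, one_mulVec] at h
    exact h
  intro v hv
  obtain ⟨u, hu⟩ := (LinearMap.injective_iff_surjective.mp hinj) ⟨v, hv⟩
  have hu' : X *ᵥ (u : n → ℂ) = v := by
    have h := congrArg Subtype.val hu
    rwa [hf] at h
  rw [← hu', mulVec_mulVec, hX, one_mulVec]
  exact u.2

/-- A matrix `X` commuting with `H` and mapping a subspace `V` into itself maps each floor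
`V ⊓ eigenspace H e` of `H` in `V` into itself: `H (X v) = X (H v) = e • X v`.
Tasaki (2020) §2.1. [folklore] -/
private theorem mulVec_mem_inf_eigenspace_of_commute (H : Matrix n n ℂ) (V : Submodule ℂ (n → ℂ))
    (e : ℂ) {X : Matrix n n ℂ} (hcomm : X * H = H * X) (hXV : ∀ v ∈ V, X *ᵥ v ∈ V) :
    ∀ v ∈ V ⊓ Module.End.eigenspace (Matrix.toLin' H) e,
      X *ᵥ v ∈ V ⊓ Module.End.eigenspace (Matrix.toLin' H) e := by
  intro v hv
  rw [Submodule.mem_inf, Module.End.mem_eigenspace_iff, Matrix.toLin'_apply] at hv ⊢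
  refine ⟨hXV v hv.1, ?_⟩
  rw [mulVec_mulVec, ← hcomm, ← mulVec_mulVec, hv.2, mulVec_smul]

end Helpers

/-- Sector ground states of `H` in the joint sector `(N, S^z = M)` are exactly the non-zero vectors of
the floor `szSector N M ⊓ eigenspace H (minEnergyOn H (szSector N M))` (unfolding of
`IsGroundStateInSector`). Tasaki (2020) §2.1. [folklore] -/
private theorem isGroundStateInSector_iff_mem_floor {Λ : Type*} [LinearOrder Λ] [Fintype Λ]
    (H : Matrix (Finset (Orb Λ)) (Finset (Orb Λ)) ℂ) (N : ℕ) (M : ℝ) (ψ : Fock (Orb Λ)) :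
    IsGroundStateInSector H N M ψ ↔
      ψ ∈ szSector N M ⊓ Module.End.eigenspace (Matrix.toLin' H)
        (((H.minEnergyOn (szSector (Λ := Λ) N M) : ℝ) : ℂ)) ∧ ψ ≠ 0 := by
  rw [IsGroundStateInSector, Submodule.mem_inf, Module.End.mem_eigenspace_iff, Matrix.toLin'_apply]
  tauto

/-- **STUB `stub_everyFromSome_torus`** (the torus instance of `stub_schurBridge`, which it takes as the
hypothesis `hSB`). For the Hubbard torus `H = hubbardTorus 2 L 1 U`, a particle number `N`, a threshold
`t` and a family `S` of unitaries commuting with `H`, preserving the sectors `(N, 0)` and `(N − 2, 0)` and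
twisting `Δ_d` by unimodular phases: if the `(N, 0)` ground floor
`szSector N 0 ⊓ eigenspace H (minEnergyOn H (szSector N 0))` is `S`-irreducible and SOME unit sector
ground states `φ₀ ∈ (N, 0)`, `χ₀ ∈ (N − 2, 0)` have `t ≤ |⟨χ₀, Δ_d φ₀⟩|²`, then EVERY unit ground state
`φ` of `(N, 0)` has a unit ground state `χ` of `(N − 2, 0)` with `t ≤ |⟨χ, Δ_d φ⟩|²`.
Serre §2.2; Tasaki (2020) §2.1. [folklore] -/
theorem stub_everyFromSome_torus
    (hSB : ∀ (n : Type) [Fintype n] [DecidableEq n] (Δ : Matrix n n ℂ) (F Fm : Submodule ℂ (n → ℂ))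
      (S : Set (Matrix n n ℂ)),
      (∀ X ∈ S, Xᴴ * X = 1) →
      (∀ X ∈ S, ∀ v ∈ F, X *ᵥ v ∈ F) → (∀ X ∈ S, ∀ v ∈ F, Xᴴ *ᵥ v ∈ F) →
      (∀ X ∈ S, ∀ v ∈ Fm, X *ᵥ v ∈ Fm) → (∀ X ∈ S, ∀ v ∈ Fm, Xᴴ *ᵥ v ∈ Fm) →
      (∀ X ∈ S, ∃ ω : ℂ, ‖ω‖ = 1 ∧ X * Δ = ω • (Δ * X)) →
      (∀ K' : Submodule ℂ (n → ℂ), K' ≤ F → (∀ X ∈ S, ∀ v ∈ K', X *ᵥ v ∈ K') →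
        K' = ⊥ ∨ K' = F) →
      ∀ t : ℝ, (∃ φ₀ ∈ F, ∃ χ₀ ∈ Fm, star φ₀ ⬝ᵥ φ₀ = 1 ∧ star χ₀ ⬝ᵥ χ₀ = 1 ∧
        t ≤ ‖star χ₀ ⬝ᵥ (Δ *ᵥ φ₀)‖ ^ 2) →
      ∀ φ ∈ F, star φ ⬝ᵥ φ = 1 → ∃ χ ∈ Fm, star χ ⬝ᵥ χ = 1 ∧ t ≤ ‖star χ ⬝ᵥ (Δ *ᵥ φ)‖ ^ 2)
    (L : ℕ) [NeZero L] (U : ℝ) (N : ℕ) (t : ℝ)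
    (S : Set (Matrix (Finset (Orb (FermionTorus 2 L))) (Finset (Orb (FermionTorus 2 L))) ℂ))
    (hS : ∀ X ∈ S, Xᴴ * X = 1 ∧ X * hubbardTorus 2 L 1 U = hubbardTorus 2 L 1 U * X ∧
      (∀ v ∈ szSector (Λ := FermionTorus 2 L) N 0, X *ᵥ v ∈ szSector (Λ := FermionTorus 2 L) N 0) ∧
      (∀ v ∈ szSector (Λ := FermionTorus 2 L) (N - 2) 0,
        X *ᵥ v ∈ szSector (Λ := FermionTorus 2 L) (N - 2) 0) ∧
      ∃ ω : ℂ, ‖ω‖ = 1 ∧ X * pairField dWaveFormFactor L = ω • (pairField dWaveFormFactor L * X))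
    (hirr : ∀ K' : Submodule ℂ (Fock (Orb (FermionTorus 2 L))),
      K' ≤ szSector (Λ := FermionTorus 2 L) N 0 ⊓
          Module.End.eigenspace (Matrix.toLin' (hubbardTorus 2 L 1 U))
            (((hubbardTorus 2 L 1 U).minEnergyOn (szSector (Λ := FermionTorus 2 L) N 0) : ℝ) : ℂ) →
      (∀ X ∈ S, ∀ v ∈ K', X *ᵥ v ∈ K') →
      K' = ⊥ ∨ K' = szSector (Λ := FermionTorus 2 L) N 0 ⊓
          Module.End.eigenspace (Matrix.toLin' (hubbardTorus 2 L 1 U))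
            (((hubbardTorus 2 L 1 U).minEnergyOn (szSector (Λ := FermionTorus 2 L) N 0) : ℝ) : ℂ))
    (hsome : ∃ φ₀ χ₀ : Fock (Orb (FermionTorus 2 L)),
      IsGroundStateInSector (hubbardTorus 2 L 1 U) N 0 φ₀ ∧ star φ₀ ⬝ᵥ φ₀ = 1 ∧
      IsGroundStateInSector (hubbardTorus 2 L 1 U) (N - 2) 0 χ₀ ∧ star χ₀ ⬝ᵥ χ₀ = 1 ∧
      t ≤ ‖star χ₀ ⬝ᵥ Matrix.mulVec (pairField dWaveFormFactor L) φ₀‖ ^ 2) :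
    ∀ φ : Fock (Orb (FermionTorus 2 L)), IsGroundStateInSector (hubbardTorus 2 L 1 U) N 0 φ →
      star φ ⬝ᵥ φ = 1 →
      ∃ χ : Fock (Orb (FermionTorus 2 L)), IsGroundStateInSector (hubbardTorus 2 L 1 U) (N - 2) 0 χ ∧
        star χ ⬝ᵥ χ = 1 ∧ t ≤ ‖star χ ⬝ᵥ Matrix.mulVec (pairField dWaveFormFactor L) φ‖ ^ 2 := by
  intro φ hφ hφ1
  -- the floor dictionary, and unit vectors are non-zero
  have hfl := fun (k : ℕ) (ψ : Fock (Orb (FermionTorus 2 L))) =>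
    isGroundStateInSector_iff_mem_floor (hubbardTorus 2 L 1 U) k 0 ψ
  have hne : ∀ ψ : Fock (Orb (FermionTorus 2 L)), star ψ ⬝ᵥ ψ = 1 → ψ ≠ 0 := by
    rintro ψ hψ rfl
    simp at hψ
  -- every `X ∈ S` maps both floors into themselves (and then so does `Xᴴ`, by unitarity)
  have hSF := fun X (hX : X ∈ S) => mulVec_mem_inf_eigenspace_of_commute (hubbardTorus 2 L 1 U)
    (szSector (Λ := FermionTorus 2 L) N 0)
    (((hubbardTorus 2 L 1 U).minEnergyOn (szSector (Λ := FermionTorus 2 L) N 0) : ℝ) : ℂ)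
    (hS X hX).2.1 (hS X hX).2.2.1
  have hSFm := fun X (hX : X ∈ S) => mulVec_mem_inf_eigenspace_of_commute (hubbardTorus 2 L 1 U)
    (szSector (Λ := FermionTorus 2 L) (N - 2) 0)
    (((hubbardTorus 2 L 1 U).minEnergyOn (szSector (Λ := FermionTorus 2 L) (N - 2) 0) : ℝ) : ℂ)
    (hS X hX).2.1 (hS X hX).2.2.2.1
  obtain ⟨φ₀, χ₀, hφ₀, hφ₀1, hχ₀, hχ₀1, ht₀⟩ := hsome
  obtain ⟨χ, hχ, hχ1, hχt⟩ := hSB (Finset (Orb (FermionTorus 2 L))) (pairField dWaveFormFactor L)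
    _ _ S (fun X hX => (hS X hX).1) hSF
    (fun X hX => conjTranspose_mulVec_mem_of_unitary _ (hS X hX).1 (hSF X hX)) hSFm
    (fun X hX => conjTranspose_mulVec_mem_of_unitary _ (hS X hX).1 (hSFm X hX))
    (fun X hX => (hS X hX).2.2.2.2) hirr t
    ⟨φ₀, ((hfl N φ₀).1 hφ₀).1, χ₀, ((hfl (N - 2) χ₀).1 hχ₀).1, hφ₀1, hχ₀1, ht₀⟩
    φ ((hfl N φ).1 hφ).1 hφ1
  exact ⟨χ, (hfl (N - 2) χ).2 ⟨hχ, hne χ hχ1⟩, hχ1, hχt⟩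

end Summit.HubbardSuperconductivity.HubbardSuperconductivity.Theorems.JosephsonMirror

end
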